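import Summits.CriticalPhenomena.SAWScalingLimit.Theorems.SAWLoopFugacityFlowIsingBoundaryRatioRSWMeshDefs
import Summits.CriticalPhenomena.SAWScalingLimit.Theorems.SAWLoopFugacityFlowIsingBoundaryRatioRoughHalfAnnulusRSWPath
import Literature.Probability.LatticeModels.MeshLoops
import Literature.Probability.LatticeModels.MeshDomainBigComponents
import Literature.Probability.RandomPlanarGeometry.ExteriorULC
import Literature.Topology.PlaneTopology.Brouwer
import Literature.Topology.PlaneTopology.JordanDomainLocalJoin
import HarnessLib

/-!
# Side-to-side crossings separate — analysis helpers
(line `fk-anchor-transfer`, crux `IsingBoundaryRatio`, stmt-CriticalPhenomena-10650; first of three modules proving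
`AnnSideCrossSeparation` of `…IsingBoundaryRatioRSWMeshDefs.lean`, see `…IsingBoundaryRatioSideCrossSeparation.lean`)

* `pol` — the log-polar chart `w ↦ log |w| + i arg w`, continuous and injective on the closed upper half-plane minus
  `0` (`continuousOn_pol`, `injOn_pol`), mapping the closed half-annulus `{ρ ≤ |w| ≤ R, im w ≥ 0}` into the
  rectangle `[log ρ, log R] × [0, π]` (`pol_mem_rect`);
* `exists_chart_extension` — the Carathéodory extension of the inverse `φ⁻¹` of a chordal uniformizing map of a
  Dobrushin domain `(D; a, b)` to `closure D ∖ {b}`: continuous, injective, equal to `φ⁻¹` on `D`, real on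
  `∂D ∖ {b}`, `0` at `a` (from the tree's disc-form extension `JordanDomain.exists_continuousOn_extension_holds`
  through the Cayley transform, `HalfPlaneAutomorphism.lean`);
* `exists_firstExit` — a path from a point of an open set `U` to a point outside has an initial piece ending on `∂U`
  with all other points in `U`;
* `re_neg_of_near` — sign bookkeeping for the feet of a prolonged crossing.

References: Ch. Pommerenke, *Boundary Behaviour of Conformal Maps* (1992), Thm. 2.6 [`PommerenkeBBCM1992`].
-/

noncomputable section

open scoped Classical Topology
open Filter Set Metric SimpleGraph Complex
open Literature.Probability.LatticeModels Literature.Probability.RandomPlanarGeometry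
open Literature.Probability.Percolation (BondConfig)
open Literature.Topology.PlaneTopology
open UpperHalfPlane (upperHalfPlaneSet)

namespace Summit.CriticalPhenomena.SAWScalingLimit.Theorems.IsingBoundaryRatio

/-! ### Log-polar coordinates on the closed upper half-plane -/

/-- Log-polar coordinates `w ↦ log |w| + i arg w`. [folklore] -/
def pol (w : ℂ) : ℂ := (Real.log ‖w‖ : ℂ) + (arg w : ℂ) * I

/-- Real part of `pol`. [folklore] -/
@[simp] theorem pol_re (w : ℂ) : (pol w).re = Real.log ‖w‖ := by simp [pol]

/-- Imaginary part of `pol`. [folklore] -/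
@[simp] theorem pol_im (w : ℂ) : (pol w).im = arg w := by simp [pol]

/-- `pol` is continuous on the closed upper half-plane minus the origin. [folklore] -/
theorem continuousOn_pol : ContinuousOn pol {w : ℂ | w ≠ 0 ∧ 0 ≤ w.im} := by
  intro w hw
  obtain ⟨hw0, hwim⟩ := hw
  have h1 : ContinuousWithinAt (fun w : ℂ => ((Real.log ‖w‖ : ℝ) : ℂ)) {w : ℂ | w ≠ 0 ∧ 0 ≤ w.im} w :=
    (continuous_ofReal.continuousAt.comp
      ((Real.continuousAt_log (norm_ne_zero_iff.2 hw0)).comp continuous_norm.continuousAt)).continuousWithinAt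
  have h2 : ContinuousWithinAt arg {w : ℂ | w ≠ 0 ∧ 0 ≤ w.im} w := by
    by_cases hs : w ∈ slitPlane
    · exact (continuousAt_arg hs).continuousWithinAt
    · have hre : w.re < 0 := by
        rw [mem_slitPlane_iff, not_or, not_lt] at hs
        rcases hs.1.eq_or_lt with h | h
        · exfalso
          apply hw0
          apply Complex.ext <;> simp_all
        · exact h
      have him : w.im = 0 := by
        rw [mem_slitPlane_iff, not_or] at hs
        simpa using hs.2
      exact (continuousWithinAt_arg_of_re_neg_of_im_zero hre him).mono fun z hz => hz.2
  have h3 : ContinuousWithinAt (fun w : ℂ => ((arg w : ℝ) : ℂ)) {w : ℂ | w ≠ 0 ∧ 0 ≤ w.im} w :=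
    continuous_ofReal.continuousAt.comp_continuousWithinAt h2
  exact h1.add (h3.mul continuousWithinAt_const)

/-- `pol` is injective away from the origin. [folklore] -/
theorem injOn_pol : InjOn pol {w : ℂ | w ≠ 0 ∧ 0 ≤ w.im} := by
  intro w hw w' hw' h
  have hre := congrArg Complex.re h
  have him := congrArg Complex.im h
  simp only [pol_re, pol_im] at hre him
  refine ext_norm_arg ?_ him
  exact Real.log_injOn_pos (norm_pos_iff.2 hw.1) (norm_pos_iff.2 hw'.1) hre

/-- `pol` maps the closed half-annulus `{ρ ≤ |w| ≤ R, im w ≥ 0}` into the rectangle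
`[log ρ, log R] × [0, π]`. [folklore] -/
theorem pol_mem_rect {ρ R : ℝ} (hρ : 0 < ρ) {w : ℂ} (h1 : ρ ≤ ‖w‖) (h2 : ‖w‖ ≤ R) (hw : 0 ≤ w.im) :
    pol w ∈ Icc (Real.log ρ) (Real.log R) ×ℂ Icc 0 Real.pi := by
  rw [mem_reProdIm, pol_re, pol_im]
  exact ⟨⟨Real.log_le_log hρ h1, Real.log_le_log (hρ.trans_le h1) h2⟩, arg_nonneg_iff.2 hw, arg_le_pi w⟩

/-! ### The chordal chart extended to the closed domain -/

/-- **Carathéodory extension of `φ⁻¹` in the half-plane form.** For a chordal uniformizing map `φ`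
of `(D; a, b)` there is `g : ℂ → ℂ`, continuous and injective on `closure D ∖ {b}`, equal to `φ⁻¹`
on `D`, real on `∂D ∖ {b}`, with `g a = 0`. [cite: PommerenkeBBCM1992, Thm. 2.6] -/
theorem exists_chart_extension {D : DobrushinDomain} {φ : ConformalEquiv upperHalfPlaneSet D.carrier}
    (hφ : D.IsChordalUniformizing φ) :
    ∃ g : ℂ → ℂ, ContinuousOn g (closure D.carrier \ {D.pt 1}) ∧ EqOn g φ.symm D.carrier ∧
      (∀ z ∈ frontier D.carrier, z ≠ D.pt 1 → (g z).im = 0) ∧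
      InjOn g (closure D.carrier \ {D.pt 1}) ∧ g (D.pt 0) = 0 := by
  obtain ⟨Ψ, hΨc, hΨeq, hbij, hbijfr⟩ :=
    JordanDomain.exists_continuousOn_extension_holds D.toJordanDomain (cayley.symm.trans φ)
  have hinj : InjOn Ψ (closedBall 0 1) := hbij.injOn
  set σ : ℂ → ℂ := extendFrom D.carrier fun w => cayleyFun (φ.symm w) with hσ
  have hσΨ : ∀ ζ ∈ closedBall (0 : ℂ) 1, σ (Ψ ζ) = ζ := fun ζ hζ =>
    extendFrom_eq (hbij.mapsTo hζ) (JordanDomain.tendsto_cayleyFun_symm φ hΨc hΨeq hinj hζ)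
  have hσc : ContinuousOn σ (closure D.carrier) := by
    refine continuousOn_extendFrom Subset.rfl fun z hz => ?_
    obtain ⟨ζ, hζ, rfl⟩ := hbij.surjOn hz
    exact ⟨ζ, JordanDomain.tendsto_cayleyFun_symm φ hΨc hΨeq hinj hζ⟩
  -- `σ z = ζ` with `Ψ ζ = z`
  have hσmem : ∀ z ∈ closure D.carrier, σ z ∈ closedBall (0 : ℂ) 1 ∧ Ψ (σ z) = z := by
    intro z hz
    obtain ⟨ζ, hζ, rfl⟩ := hbij.surjOn hz
    rw [hσΨ ζ hζ]
    exact ⟨hζ, rfl⟩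
  have hb : Ψ 1 = D.pt 1 := JordanDomain.extension_one_eq φ hΨc hΨeq hφ.2
  have hσne : ∀ z ∈ closure D.carrier \ {D.pt 1}, σ z ≠ 1 := by
    rintro z ⟨hz, hzb⟩ h1
    have := (hσmem z hz).2
    rw [h1, hb] at this
    exact hzb this.symm
  refine ⟨fun z => cayleyInvFun (σ z), ?_, ?_, ?_, ?_, ?_⟩
  · refine differentiableOn_cayleyInvFun.continuousOn.comp (hσc.mono fun z hz => hz.1) fun z hz => ?_
    exact hσne z hz
  · intro w hw
    have hw' : 0 ≤ (φ.symm w).im := le_of_lt (φ.symm_mapsTo hw)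
    have hζ : cayleyFun (φ.symm w) ∈ closedBall (0 : ℂ) 1 :=
      ball_subset_closedBall (cayley.mapsTo (φ.symm_mapsTo hw))
    have h1 : σ w = cayleyFun (φ.symm w) := by
      have h2 := hσΨ _ hζ
      rwa [JordanDomain.apply_cayleyFun_symm φ hΨeq hw] at h2
    show cayleyInvFun (σ w) = φ.symm w
    rw [h1, cayleyInvFun_cayleyFun (add_I_ne_zero hw')]
  · intro z hz _
    obtain ⟨ζ, hζ, rfl⟩ := hbijfr.surjOn hz
    show (cayleyInvFun (σ (Ψ ζ))).im = 0
    rw [hσΨ ζ (sphere_subset_closedBall hζ)]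
    exact cayleyInvFun_im_eq_zero (mem_sphere_zero_iff_norm.1 hζ)
  · intro z hz z' hz' h
    have h1 : cayleyFun (cayleyInvFun (σ z)) = cayleyFun (cayleyInvFun (σ z')) := by
      show cayleyFun ((fun z => cayleyInvFun (σ z)) z) = _
      rw [h]
    rw [cayleyFun_cayleyInvFun (hσne z hz), cayleyFun_cayleyInvFun (hσne z' hz')] at h1
    rw [← (hσmem z hz.1).2, ← (hσmem z' hz'.1).2, h1]
  · have ha : Ψ (cayleyFun ((0 : ℝ) : ℂ)) = D.pt 0 := JordanDomain.extension_cayleyFun_eq φ hΨc hΨeq hφ.1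
    have h0 : cayleyFun ((0 : ℝ) : ℂ) ∈ closedBall (0 : ℂ) 1 :=
      mem_closedBall_zero_iff.2 (norm_cayleyFun_ofReal 0).le
    show cayleyInvFun (σ (D.pt 0)) = 0
    rw [← ha, hσΨ _ h0, cayleyInvFun_cayleyFun (add_I_ne_zero (by simp))]
    simp

/-! ### Truncating a path at its first exit from an open set -/

/-- **First exit.** A path from a point of the open set `U` to a point outside `U` has an initial
piece ending on `∂U`, all of whose other points lie in `U`. [folklore] -/
theorem exists_firstExit {x y : ℂ} (P : Path x y) {U : Set ℂ} (hU : IsOpen U) (hx : x ∈ U) (hy : y ∉ U) :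
    ∃ (q : ℂ) (Q : Path x q), q ∈ frontier U ∧ range Q ⊆ range P ∧ ∀ t, Q t ∈ U ∨ Q t = q := by
  set T : Set ℝ := Icc 0 1 ∩ P.extend ⁻¹' Uᶜ with hT
  have hTc : IsClosed T := isClosed_Icc.inter (hU.isClosed_compl.preimage P.continuous_extend)
  have hTne : T.Nonempty := ⟨1, ⟨right_mem_Icc.2 zero_le_one, by simpa using hy⟩⟩
  have hTbdd : BddBelow T := ⟨0, fun t ht => ht.1.1⟩
  set s := sInf T with hs
  have hsT : s ∈ T := hTc.csInf_mem hTne hTbdd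
  have hs0 : 0 ≤ s := hsT.1.1
  have hs1 : s ≤ 1 := hsT.1.2
  have hlt : ∀ t, 0 ≤ t → t < s → P.extend t ∈ U := by
    intro t ht0 hts
    by_contra h
    have : s ≤ t := csInf_le hTbdd ⟨⟨ht0, hts.le.trans hs1⟩, h⟩
    linarith
  have hspos : 0 < s := by
    rcases hs0.eq_or_lt with h | h
    · exfalso
      have : P.extend s ∉ U := hsT.2
      rw [← h, P.extend_zero] at this
      exact this hx
    · exact h
  set q := P.extend s with hq
  have hqU : q ∉ U := hsT.2
  have hqcl : q ∈ closure U := by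
    have htend : Tendsto (fun n : ℕ => P.extend (s - s / (n + 2))) atTop (𝓝 q) := by
      have h1 : Tendsto (fun n : ℕ => s - s / ((n : ℝ) + 2)) atTop (𝓝 s) := by
        have : Tendsto (fun n : ℕ => s / ((n : ℝ) + 2)) atTop (𝓝 0) := by
          have h2 : Tendsto (fun n : ℕ => (n : ℝ) + 2) atTop atTop :=
            tendsto_atTop_add_const_right _ _ tendsto_natCast_atTop_atTop
          exact tendsto_const_nhds.div_atTop h2
        simpa using tendsto_const_nhds.sub this
      exact (P.continuous_extend.tendsto s).comp h1
    refine mem_closure_of_tendsto htend (Eventually.of_forall fun n => hlt _ ?_ ?_)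
    · have : s / ((n : ℝ) + 2) ≤ s := div_le_self hs0 (by linarith [n.cast_nonneg (α := ℝ)])
      linarith
    · have : 0 < s / ((n : ℝ) + 2) := div_pos hspos (by positivity)
      linarith
  have hqfr : q ∈ frontier U := by
    rw [hU.frontier_eq]  -- frontier U = closure U \ U
    exact ⟨hqcl, hqU⟩
  refine ⟨q, ⟨⟨fun t => P.extend (s * t), ?_⟩, ?_, ?_⟩, hqfr, ?_, ?_⟩
  · exact P.continuous_extend.comp (continuous_const.mul continuous_subtype_val)
  · simp
  · simp [hq]
  · rintro _ ⟨t, rfl⟩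
    show P.extend (s * t) ∈ range P
    rw [← P.extend_range]
    exact mem_range_self _
  · intro t
    show P.extend (s * t) ∈ U ∨ P.extend (s * t) = q
    rcases (mul_le_of_le_one_right hs0 t.2.2).eq_or_lt with h | h
    · right; rw [h]
    · left; exact hlt _ (mul_nonneg hs0 t.2.1) h

/-! ### Sign bookkeeping -/

/-- Sign bookkeeping for the feet of the prolonged crossing: a real number `w` within `m` of a complex
number `G` with `|G| ≥ r₁ ≥ 2m` and `re G < 0` is negative. [folklore] -/
theorem re_neg_of_near {G w : ℂ} {r₁ m : ℝ} (hm : 0 < m) (hmr : 2 * m ≤ r₁) (hG : r₁ ≤ ‖G‖) (hGre : G.re < 0)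
    (hw : (w).im = 0) (hd : dist w G < m) : w.re < 0 := by
  have h1 : |G.im| < m := by
    have : |(G - w).im| ≤ ‖G - w‖ := abs_im_le_norm _
    rw [sub_im, hw, sub_zero] at this
    rw [_root_.dist_comm, dist_eq_norm] at hd
    linarith
  have h2 : ‖G‖ ^ 2 = G.re ^ 2 + G.im ^ 2 := by
    rw [← normSq_eq_norm_sq, normSq_apply]; ring
  have h3 : (r₁ - m) ^ 2 < G.re ^ 2 := by
    have him2 : G.im ^ 2 < m ^ 2 := by
      have := sq_lt_sq' (abs_lt.1 h1).1 (abs_lt.1 h1).2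
      simpa using this
    have hr : r₁ ^ 2 ≤ ‖G‖ ^ 2 := by
      have : 0 ≤ r₁ := by linarith
      exact pow_le_pow_left₀ this hG 2
    nlinarith
  have h4 : G.re < -(r₁ - m) := by
    by_contra h
    push Not at h
    have : G.re ^ 2 ≤ (r₁ - m) ^ 2 := by
      have h5 : 0 ≤ r₁ - m := by linarith
      nlinarith
    linarith
  have h5 : |(w - G).re| ≤ ‖w - G‖ := abs_re_le_norm _
  rw [dist_eq_norm] at hd
  rw [sub_re] at h5
  have h6 := (abs_lt.1 (h5.trans_lt hd)).2
  linarith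

/-- `pol` is injective away from the origin, closed form (registered sub-goal of stmt-CriticalPhenomena-10650). [folklore] -/
theorem injOn_pol' : InjOn pol {w : ℂ | w ≠ 0 ∧ 0 ≤ w.im} :=
  injOn_pol

end Summit.CriticalPhenomena.SAWScalingLimit.Theorems.IsingBoundaryRatio

end
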